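import Summits.Schanuel.Schanuel.Theorems.RootDecomp1KLocalExponent03

/-!
# RootDecomp1KLocalExponent — lens 1, generation 54, NODE 14 «THE LOCAL EXPONENT: the named targets contactC at m₀ = 2 and highContactC at m₀ = 2, 3, 4 decided hypothesis-free» (RULE K-R42 (vii′) named-target clause, K-R44, K-R45) — continuation (RootDecomp1KLocalExponent04): §6 positioning, §7 the top Y⁵ − 1, §8 the named targets contactC / highContactC

(lens-1 g54 NODE 14 HOME kernel K = HOME/decomp-schanuel-lens-1/g54/LocalExponent.lean 0a24ac98…, 1537 l, 93 thm + 7 def, imports tree …RootDecomp1KHeightMachine05 ONLY (no Literature import); Probe / Ctrl0 / Ctrl + NODE-g54.md + SHA256SUMS; CLAIM L2617, crit EX-ANTE PRICE L2618 (ONE THEOREM ×1 under RULE K-R42 (vii′), NAMED-TARGET clause of L2599, iff CHECKLIST K-g54; RULE K-R45 pre-announced: local toolkit closure + frontier certificate, census instrument LIVENESS-v4), NODE L2621 / REQUEST L2622, census STAGING NOTE 4 L2623, critic VERDICT L2624: CLEARED — THEOREM ×1 under RULE K-R42 (vii′) (named-target clause), CHECKLIST K-g54 met; RULE K-R45 FIXED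 (local suppliers of record; LIVENESS-v4 = frontier certificate; unconditional part DecidedAt ∨ MachineDecidedAt ∨ LocalAt); PORT GO (verbatim; docstrings / the sanctioned privatisation only). Port by census-1 gen 22 as `RootDecomp1KLocalExponent01–06` (`--supports stmt-Schanuel-33364`; no census credit): 01 = §1 helpers + §2 the three local inputs (closed range of ℚ₂ in ℂ₂ `exists_pos_le_norm_ratCast_sub`; the 2-adic LIOUVILLE inequality at a RATIONAL centre `liouville_rat`; the nearest root with its OWN multiplicity); 02 = §3 the bounded region near a root + §4 the point (∞,∞) by its NEWTON SLOPES (`dTop`, `far_slope`, `slope_arith`, `FarClause`, `SlopeCond`, `farClause_of_slopeCond`, `farClause_of_empty`); 03 = §5 THE THEOREM **`thinFibreAt_of_localAt : LocalAt m₀ P → ThinFibreAt m₀ P`** (every m₀; `rootMult`, `RootCond`, `LocalAt`, engine `thinFibreAt_of_rootCond_farClause`, spelled-out `thinFibreAt_local`) + §5b presentation independence `localAt_iff`; 04 = §6 positioning (`localAt_of_thinThreshold_le`, `localAt_of_rootlessTop(_le)`, the tree theorems re-derived) + §7 the top Y⁵ − 1 (`padic_pow_five_eq_one`, `rootCond_two_pow_five_sub_one`)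 + §8 the NAMED TARGETS **`thinFibreAt_contact_two : ThinFibreAt 2 (xPolyP 2 contactC)`**, `thinFibreAt_highContact_three` / `_four` / `_highContact'`; 05 = §9 costume tests of the members + two refused tops; 06 = §10 **`thinFibreAt_highContact_two`** (outside the class: the critical segment v₂(r) = −N!/2 is EMPTY) + §11 bookkeeping ×0 (`LocalOffAt`, residual re-graded). PORT EDITS: the two generic one-liners `norm_natCast_le_one_Cp` / `norm_intCast_le_one_Cp` PRIVATISED (head dry-run dedup.foreign notes vs Summit.ABC… / Summit.BirchSwinnertonDyer… twins; file-local copies re-emitted where used); otherwise none on declarations (K fully documented; no set_option / cite-token); provenance doc blocks + continuation headers = K's own open-lines only; statements and proofs VERBATIM. Rung 0 — nothing here proves Schanuel, 33364, 33363, 31077 or ThinFibre 2; the class `LocalAt` and the named targets are HYPOTHESIS-FREE, §11 is conditional on PadicSubspace / HeightComparison.)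
-/

noncomputable section

namespace Summit.Schanuel.Schanuel.Theorems.RootDecomp1KLocalExponent

open Polynomial LiouvilleNumber
open scoped Nat
open Summit.Schanuel.Schanuel.Theorems.RootDecomp1KTwoBaseCell (psNumer partialSum_eq_psNumer_div coprime_psNumer)
open Summit.Schanuel.Schanuel.Theorems.RootDecomp1KRelLiouvilleCell (partialSum_two_strictMono)
open Summit.Schanuel.Schanuel.Theorems.RootDecomp1KDegreeLadder
open Summit.Schanuel.Schanuel.Theorems.RootDecomp1KXLinearCore
open Summit.Schanuel.Schanuel.Theorems.RootDecomp1KXLinear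
open Summit.Schanuel.Schanuel.Theorems.RootDecomp1KXLinearII
open Summit.Schanuel.Schanuel.Theorems.RootDecomp1KXTop
open Summit.Schanuel.Schanuel.Theorems.RootDecomp1KXAll
open Summit.Schanuel.Schanuel.Theorems.RootDecomp1KLevelFinite
open Summit.Schanuel.Schanuel.Theorems.RootDecomp1KSubspaceBranch
open Summit.Schanuel.Schanuel.Theorems.RootDecomp1KHeightMachine

/-! ## §6  POSITIONING: `LocalAt m₀` CONTAINS the threshold class (node 5) and the rootless-top class (node 10) -/

/-- `thinThreshold P ≤ m₀ ⟹ LocalAt m₀ P` — node 5's `thinFibreAt_all` is a COROLLARY of node 14 (every root by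
branch (iii) with `μ_β ≤ μ(P)`, every slope by `deg c_j − deg c_k ≤ e(P) < m₀ ≤ m₀·(k − j)`). -/
theorem localAt_of_thinThreshold_le {P : ℤ[X][X]} (hP : P ≠ 0) {m₀ : ℕ} (hm : thinThreshold P ≤ m₀) :
    LocalAt m₀ P := by
  have hμ : 2 * muTop P + 1 ≤ m₀ := le_trans ((le_max_left _ _).trans (le_max_right _ _)) hm
  have he : eTop P + 1 ≤ m₀ := le_trans ((le_max_right _ _).trans (le_max_right _ _)) hm
  refine ⟨xdeg P, xCoeff P, topX_ne_zero hP, (xPolyP_xCoeff P).symm, fun β _ => ?_, fun j hj hdj => ?_⟩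
  · refine Or.inr (Or.inr (le_trans ?_ hμ))
    have := rootMultiplicity_le_muTop P β
    unfold rootMult; unfold topX at this
    omega
  · have h1 := natDegree_xCoeff_le P j
    have h2 : (xCoeff P j).natDegree - (xCoeff P (xdeg P)).natDegree ≤ eTop P := by
      show _ ≤ P.natDegree - (topX P).natDegree
      unfold topX; omega
    have hkj : 1 ≤ xdeg P - j := by omega
    calc (xCoeff P j).natDegree - (xCoeff P (xdeg P)).natDegree ≤ eTop P := h2
      _ < m₀ := he
      _ ≤ m₀ * (xdeg P - j) := Nat.le_mul_of_pos_right _ hkj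

/-- node 5's theorem RE-DERIVED from node 14. -/
theorem thinFibreAt_all_again (P : ℤ[X][X]) (hP : P ≠ 0) {m₀ : ℕ} (hm : thinThreshold P ≤ m₀) : ThinFibreAt m₀ P :=
  thinFibreAt_of_localAt (localAt_of_thinThreshold_le hP hm)

/-- `RootlessTop e P ⟹ LocalAt (e + 1) P` — node 10's `thinFibreAt_of_rootlessTop` is a COROLLARY of node 14
(every root by branch (i); every slope by `deg c_j − deg c_k ≤ e < (e + 1)(k − j)`). -/
theorem localAt_of_rootlessTop {e : ℕ} {P : ℤ[X][X]} (hP : RootlessTop e P) : LocalAt (e + 1) P := by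
  obtain ⟨k, c, hdeg, hroot, rfl⟩ := hP
  have hB : c k ≠ 0 := by
    intro h0
    exact hroot 0 (by rw [h0, map_zero])
  refine ⟨k, c, hB, rfl, fun β hβ => Or.inl fun y hy => ?_, fun j hj hdj => ?_⟩
  · apply hroot y
    have hinj : Function.Injective (algebraMap ℚ_[2] (PadicAlgCl 2)) := (algebraMap ℚ_[2] (PadicAlgCl 2)).injective
    apply hinj
    rw [map_zero]
    have h1 : algebraMap ℚ_[2] (PadicAlgCl 2) (aeval y (c k)) = aeval (algebraMap ℚ_[2] (PadicAlgCl 2) y) (c k) := by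
      rw [aeval_def, aeval_def, hom_eval₂]
      exact congrArg (fun f : ℤ →+* PadicAlgCl 2 => eval₂ f (algebraMap ℚ_[2] (PadicAlgCl 2) y) (c k))
        (RingHom.ext_int _ _)
    rw [h1, hy, hβ]
  · have := hdeg j hj
    have hkj : 1 ≤ k - j := by omega
    calc (c j).natDegree - (c k).natDegree ≤ e := by omega
      _ < e + 1 := Nat.lt_succ_self e
      _ ≤ (e + 1) * (k - j) := Nat.le_mul_of_pos_right _ hkj

/-- node 10's theorem RE-DERIVED from node 14. -/
theorem thinFibreAt_of_rootlessTop_again {e : ℕ} {P : ℤ[X][X]} (hP : RootlessTop e P) {m₀ : ℕ} (hme : e + 1 ≤ m₀) :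
    ThinFibreAt m₀ P :=
  thinFibreAt_of_localAt (localAt_mono hme (localAt_of_rootlessTop hP))

/-- node 10's class with the tree's binder `e + 1 ≤ m₀`: `RootlessTop e P → e + 1 ≤ m₀ → LocalAt m₀ P`. -/
theorem localAt_of_rootlessTop_le {e : ℕ} {P : ℤ[X][X]} (hP : RootlessTop e P) {m₀ : ℕ} (hme : e + 1 ≤ m₀) :
    LocalAt m₀ P :=
  localAt_mono hme (localAt_of_rootlessTop hP)

/-! ## §7  The top `Y⁵ − 1`: the only fifth root of unity of `ℚ₂` is `1`; ROOT CONDITION at `m₀ = 2` -/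

/-- `‖5‖₂ = 1` in `ℚ₂`. -/
theorem norm_five_padic : ‖(5 : ℚ_[2])‖ = 1 := by
  have hle : ‖((5 : ℤ) : ℚ_[2])‖ ≤ 1 := Padic.norm_int_le_one 5
  have hlt : ¬ ‖((5 : ℤ) : ℚ_[2])‖ < 1 := by
    rw [Padic.norm_intCast_lt_one_iff]; decide
  push_cast at hle hlt
  exact le_antisymm hle (not_lt.mp hlt)

/-- **the only fifth root of unity in `ℚ₂` is `1`**: a unit `y` of `ℚ₂` has `‖y − 1‖₂ < 1` (residue field `𝔽₂`),
whence `‖(y⁴ + y³ + y² + y + 1) − 5‖₂ < 1 = ‖5‖₂` and the cyclotomic factor does not vanish. -/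
theorem padic_pow_five_eq_one {y : ℚ_[2]} (hy : y ^ 5 = 1) : y = 1 := by
  have hn : ‖y‖ = 1 := by
    have h := congrArg (fun t : ℚ_[2] => ‖t‖) hy
    simp only [norm_pow, norm_one] at h
    exact (pow_eq_one_iff_of_nonneg (norm_nonneg y) (by norm_num)).mp h
  have h1 : ‖y - 1‖ < 1 := by
    set x : ℤ_[2] := ⟨y, hn.le⟩ with hx
    have hxy : ((x : ℤ_[2]) : ℚ_[2]) = y := rfl
    obtain ⟨n, hn2, hmem⟩ := PadicInt.exists_mem_range x
    have hlt : ‖x - n‖ < 1 := PadicInt.mem_nonunits.mp ((IsLocalRing.mem_maximalIdeal _).mp hmem)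
    rw [PadicInt.norm_def, PadicInt.coe_sub, PadicInt.coe_natCast, hxy] at hlt
    interval_cases n
    · rw [Nat.cast_zero, sub_zero] at hlt; linarith
    · rw [Nat.cast_one] at hlt; exact hlt
  have htwo : ‖(2 : ℚ_[2])‖ ≤ 1 := by exact_mod_cast Padic.norm_int_le_one (p := 2) 2
  have hthree : ‖(3 : ℚ_[2])‖ ≤ 1 := by exact_mod_cast Padic.norm_int_le_one (p := 2) 3
  have hy1 : ‖y - 1‖ ≤ 1 := h1.le
  have h2 : ‖y ^ 2 - 1‖ < 1 := by
    have e : y ^ 2 - 1 = (y - 1) * ((y - 1) + 2) := by ring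
    rw [e, norm_mul]
    calc ‖y - 1‖ * ‖y - 1 + 2‖ ≤ ‖y - 1‖ * 1 :=
          mul_le_mul_of_nonneg_left ((Padic.nonarchimedean _ _).trans (max_le hy1 htwo)) (norm_nonneg _)
      _ < 1 := by rw [mul_one]; exact h1
  have h3 : ‖y ^ 3 - 1‖ < 1 := by
    have e : y ^ 3 - 1 = (y - 1) * ((y ^ 2 - 1) + (y - 1) + 3) := by ring
    rw [e, norm_mul]
    calc ‖y - 1‖ * ‖y ^ 2 - 1 + (y - 1) + 3‖ ≤ ‖y - 1‖ * 1 := by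
          refine mul_le_mul_of_nonneg_left ?_ (norm_nonneg _)
          refine (Padic.nonarchimedean _ _).trans (max_le ?_ hthree)
          exact (Padic.nonarchimedean _ _).trans (max_le h2.le hy1)
      _ < 1 := by rw [mul_one]; exact h1
  have h4 : ‖y ^ 4 - 1‖ < 1 := by
    have e : y ^ 4 - 1 = (y ^ 2 - 1) * ((y ^ 2 - 1) + 2) := by ring
    rw [e, norm_mul]
    calc ‖y ^ 2 - 1‖ * ‖y ^ 2 - 1 + 2‖ ≤ ‖y ^ 2 - 1‖ * 1 :=
          mul_le_mul_of_nonneg_left ((Padic.nonarchimedean _ _).trans (max_le h2.le htwo)) (norm_nonneg _)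
      _ < 1 := by rw [mul_one]; exact h2
  set S : ℚ_[2] := y ^ 4 + y ^ 3 + y ^ 2 + y + 1 with hS
  have hS5 : ‖S - 5‖ < 1 := by
    have e : S - 5 = (y ^ 4 - 1) + (y ^ 3 - 1) + ((y ^ 2 - 1) + (y - 1)) := by rw [hS]; ring
    rw [e]
    refine lt_of_le_of_lt (Padic.nonarchimedean _ _) (max_lt ?_ ?_)
    · exact lt_of_le_of_lt (Padic.nonarchimedean _ _) (max_lt h4 h3)
    · exact lt_of_le_of_lt (Padic.nonarchimedean _ _) (max_lt h2 h1)
  have hSne : S ≠ 0 := by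
    intro h0
    rw [h0, zero_sub, norm_neg, norm_five_padic] at hS5
    exact lt_irrefl _ hS5
  have hfac : (y - 1) * S = 0 := by
    have e : (y - 1) * S = y ^ 5 - 1 := by rw [hS]; ring
    rw [e, hy, sub_self]
  rcases mul_eq_zero.mp hfac with h | h
  · exact sub_eq_zero.mp h
  · exact (hSne h).elim

/-- `deg (Y⁵ − 1) = 5`. -/
theorem natDegree_pow_five_sub_one : (X ^ 5 - 1 : ℤ[X]).natDegree = 5 := by rw [← C_1, natDegree_X_pow_sub_C]

/-- `Y⁵ − 1 ≠ 0`. -/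
theorem pow_five_sub_one_ne_zero : (X ^ 5 - 1 : ℤ[X]) ≠ 0 := fun h => by
  have := natDegree_pow_five_sub_one; rw [h, natDegree_zero] at this; exact absurd this (by norm_num)

/-- `Y⁵ − 1` is separable over `ℚ`. -/
theorem separable_pow_five_sub_one : ((X ^ 5 - 1 : ℤ[X]).map (Int.castRingHom ℚ)).Separable := by
  rw [Polynomial.map_sub, Polynomial.map_pow, Polynomial.map_X, Polynomial.map_one, ← C_1]
  exact separable_X_pow_sub_C (1 : ℚ) (by norm_num) one_ne_zero

/-- **the ROOT CONDITION at `m₀ = 2` for the top `Y⁵ − 1`**: the root `1` is RATIONAL and SIMPLE (branch (ii),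
`1 + 1 ≤ 2`); the four primitive fifth roots of unity are OUTSIDE `ℚ₂` (branch (i)). -/
theorem rootCond_two_pow_five_sub_one : RootCond 2 (X ^ 5 - 1 : ℤ[X]) := by
  intro β hβ
  have hβ5 : β ^ 5 = 1 := by
    have h : aeval β (X ^ 5 - 1 : ℤ[X]) = β ^ 5 - 1 := by simp
    rw [h] at hβ; exact sub_eq_zero.mp hβ
  by_cases h1 : β = 1
  · refine Or.inr (Or.inl ⟨1, by rw [h1, Rat.cast_one], ?_⟩)
    have := rootMultiplicity_le_one_of_separable (X ^ 5 - 1 : ℤ[X]) separable_pow_five_sub_one β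
    unfold rootMult; omega
  · refine Or.inl fun y hy => h1 ?_
    have hy5 : y ^ 5 = 1 := by
      apply (algebraMap ℚ_[2] (PadicAlgCl 2)).injective
      rw [map_pow, map_one, hy, hβ5]
    rw [← hy, padic_pow_five_eq_one hy5, map_one]

/-! ## §8  MEMBERS: the NAMED TARGETS `contactC` at `m₀ = 2` and `highContactC` at `m₀ = 3, 4` (L2599 (vii′)) -/

/-- `contactC 2 = Y⁵ − 1`. -/
theorem contactC_two : contactC 2 = X ^ 5 - 1 := rfl
/-- `highContactC 2 = Y⁵ − 1`. -/
theorem highContactC_two : highContactC 2 = X ^ 5 - 1 := rfl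
/-- `deg (contactC 0) = 7`. -/
theorem natDegree_contactC_zero : (contactC 0).natDegree = 7 := by
  show (X ^ 7 - 1 : ℤ[X]).natDegree = 7; rw [← C_1, natDegree_X_pow_sub_C]
/-- `deg (contactC 1) = 2`. -/
theorem natDegree_contactC_one : (contactC 1).natDegree = 2 := by
  show (X ^ 2 + 1 : ℤ[X]).natDegree = 2; rw [← C_1, natDegree_X_pow_add_C]
/-- `deg (contactC 2) = 5`. -/
theorem natDegree_contactC_two : (contactC 2).natDegree = 5 := natDegree_pow_five_sub_one
/-- `deg (highContactC 0) = 9`. -/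
theorem natDegree_highContactC_zero : (highContactC 0).natDegree = 9 := by
  show (X ^ 9 - 1 : ℤ[X]).natDegree = 9; rw [← C_1, natDegree_X_pow_sub_C]
/-- `deg (highContactC 1) = 1`. -/
theorem natDegree_highContactC_one : (highContactC 1).natDegree = 1 := by
  show (X : ℤ[X]).natDegree = 1; exact natDegree_X
/-- `deg (highContactC 2) = 5`. -/
theorem natDegree_highContactC_two : (highContactC 2).natDegree = 5 := natDegree_pow_five_sub_one

/-- the SLOPE CONDITION for `contactC` at every `m₀ ≥ 2`: the one slope is `(2 − 0)/(7 − 5) = 1 > 1/2`. -/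
theorem slopeCond_contact {m₀ : ℕ} (hm : 2 ≤ m₀) : SlopeCond m₀ 2 contactC := by
  intro j hj hdj
  interval_cases j
  · rw [natDegree_contactC_zero, natDegree_contactC_two]; omega
  · rw [natDegree_contactC_one, natDegree_contactC_two] at hdj; omega

/-- the SLOPE CONDITION for `highContactC` at every `m₀ ≥ 3`: the one slope is `(2 − 0)/(9 − 5) = 1/2 > 1/3`. -/
theorem slopeCond_highContact {m₀ : ℕ} (hm : 3 ≤ m₀) : SlopeCond m₀ 2 highContactC := by
  intro j hj hdj
  interval_cases j
  · rw [natDegree_highContactC_zero, natDegree_highContactC_two]; omega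
  · rw [natDegree_highContactC_one, natDegree_highContactC_two] at hdj; omega

/-- (c-γ) … and it FAILS at `m₀ = 2` (`1/2 ≯ 1/2`: `9 − 5 = 4 < 2·2` is false — the critical slope). -/
theorem not_slopeCond_two_highContact : ¬ SlopeCond 2 2 highContactC := fun h => by
  have := h 0 (by norm_num) (by rw [natDegree_highContactC_zero, natDegree_highContactC_two]; norm_num)
  rw [natDegree_highContactC_zero, natDegree_highContactC_two] at this
  omega

/-- **`contactC ∈ LocalAt m₀` for every `m₀ ≥ 2`.** -/
theorem localAt_contact {m₀ : ℕ} (hm : 2 ≤ m₀) : LocalAt m₀ (xPolyP 2 contactC) :=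
  ⟨2, contactC, pow_five_sub_one_ne_zero, rfl, rootCond_mono hm rootCond_two_pow_five_sub_one, slopeCond_contact hm⟩

/-- **NAMED TARGET 1 (L2599 (vii′)): `ThinFibreAt 2 (xPolyP 2 contactC)` — HYPOTHESIS-FREE** (tree: `3 ≤ m₀`,
`RootDecomp1KXTop.thinFibreAt_contact`). -/
theorem thinFibreAt_contact_two : ThinFibreAt 2 (xPolyP 2 contactC) := thinFibreAt_of_localAt (localAt_contact le_rfl)

/-- `contactC` at every `m₀ ≥ 2`. -/
theorem thinFibreAt_contact' {m₀ : ℕ} (hm : 2 ≤ m₀) : ThinFibreAt m₀ (xPolyP 2 contactC) :=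
  thinFibreAt_of_localAt (localAt_contact hm)

/-- **`highContactC ∈ LocalAt m₀` for every `m₀ ≥ 3`.** -/
theorem localAt_highContact {m₀ : ℕ} (hm : 3 ≤ m₀) : LocalAt m₀ (xPolyP 2 highContactC) :=
  ⟨2, highContactC, pow_five_sub_one_ne_zero, rfl, rootCond_mono (le_trans (by norm_num) hm) rootCond_two_pow_five_sub_one,
    slopeCond_highContact hm⟩

/-- **NAMED TARGET 2: `ThinFibreAt 3 (xPolyP 2 highContactC)` — HYPOTHESIS-FREE** (tree: `5 ≤ m₀`). -/
theorem thinFibreAt_highContact_three : ThinFibreAt 3 (xPolyP 2 highContactC) :=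
  thinFibreAt_of_localAt (localAt_highContact le_rfl)

/-- **NAMED TARGET 3: `ThinFibreAt 4 (xPolyP 2 highContactC)` — HYPOTHESIS-FREE.** -/
theorem thinFibreAt_highContact_four : ThinFibreAt 4 (xPolyP 2 highContactC) :=
  thinFibreAt_of_localAt (localAt_highContact (by norm_num))

/-- `highContactC` at every `m₀ ≥ 3`. -/
theorem thinFibreAt_highContact' {m₀ : ℕ} (hm : 3 ≤ m₀) : ThinFibreAt m₀ (xPolyP 2 highContactC) :=
  thinFibreAt_of_localAt (localAt_highContact hm)

/-- (c-δ) `highContactC ∉ LocalAt 2` (the slope `1/2` is CRITICAL at `m₀ = 2`; node 14's class is honest about it —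
the member is decided at `m₀ = 2` only by the EMPTINESS of the critical segment, §10). -/
theorem not_localAt_two_highContact : ¬ LocalAt 2 (xPolyP 2 highContactC) := by
  intro h
  have hS := slopeCond_xCoeff_of_localAt h
  rw [xdeg_xPolyP 2 highContactC pow_five_sub_one_ne_zero] at hS
  apply not_slopeCond_two_highContact
  intro j hj hdj
  have hj' : xCoeff (xPolyP 2 highContactC) j = highContactC j := by rw [xCoeff_xPolyP, if_pos hj.le]
  have hk' : xCoeff (xPolyP 2 highContactC) 2 = highContactC 2 := by rw [xCoeff_xPolyP, if_pos le_rfl]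
  have := hS j hj (by rw [hj', hk']; exact hdj)
  rwa [hj', hk'] at this

end Summit.Schanuel.Schanuel.Theorems.RootDecomp1KLocalExponent

end
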